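import Summits.BirchSwinnertonDyer.Rank1Residual.X11b.Three.CornerSplitResidual
import HarnessLib

/-!
# Routes `ClassRecordThree` / `KolyvaginRoadThree` (rung K2@3), crux 7 `CornerAtThree` (item
# stmt-BirchSwinnertonDyer-19111): the ∃-RECUT of the (Tw) conjunct — ONE odd Heegner twin per corner pair —
# as a Theses-free predicate (definitions home; cell `bsd-stepL`, seat `bsd-stepL-mult-p3` g4; plan g37 RULING 33
# STEP 1; crux idea F «one-datum re-cut + unit/exact-twin supply» of planner `bsd-stepL-mult-idea` g4)

`--supports stmt-BirchSwinnertonDyer-19111 --as helper`. This module imports NO Theses file and NO `Cruxes/` file, so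
both route files wanting item 19111 may import it and name the object. ONE `Prop`-valued PREDICATE (tagged
`@[conjecture]`: implied by BSD together with Hoffstein–Luo's non-vanishing theorem; nothing is asserted) and ONE
bookkeeping theorem (the recut is WEAKER than the filed conjunct); NO named fact; no `sorry`.

## Why

The (Tw) conjunct of `CornerAtThree`, `X11b.Three.CornerTwistAt W` — «for EVERY imaginary quadratic `K` with odd
`d_K`, Heegner for `N_E`, `L(E^{d_K},1) ≠ 0`, and every global minimal model `Wd` of the twist: `BSDp Wd 3`» — is
CONSUMED ONLY EXISTENTIALLY by its three consumers (`Three/CornerResidual.lean` `missingUpperBoundAt_of_cornerUpperAt`,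
`Three/CornerSplitResidual.lean` `missingLowerBoundAt_of_cornerStepLAt_of_cornerTwistAt`, `Three/CornerDischarge.lean`
`missingPPartAt_of_corner_of_inputs`): each does `obtain ⟨K, …⟩ := exists_oddHeegnerData …` and applies (Tw) at that
ONE field. `CornerTwistWitnessAt W` below asks for exactly what is consumed: SOME odd Heegner field `K` with
`d_K < -4` (so `w_K = 2`), Heegner for `N_E` and for `3` (so `3` splits, `3 ∤ d_K`), `L(E^{d_K},1) ≠ 0`, and the
rank-`0` `3`-part of BSD of a global minimal model of the twist. It is STRICTLY WEAKER than the ∀-form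
(`cornerTwistWitnessAt_of_cornerTwistAt`: Hoffstein–Luo supplies the field) and closes-SUFFICIENT (the replays in
`Theorems/ClassRecordThreeCornerTwistWitnessKernel.lean`). Body VERBATIM = the planner's kernel-checked sketch
`Cruxes/CornerAtThree/IdeaOneDatumRecutUnitTwinSketch.lean` ll. 35–43 (namespace moved here so that routes may cite it).

STATUS IN PRINT of the twin's `BSD₃`: the twist pair `(E^{d_K}, 3)` is analytic rank `0`, split multiplicative at
`3`, `E^{d_K}[3]` irreducible and NOT surjective, without a (ram) prime — its `≤`-half is Wuthrich 2014 Prop. 21 ∕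
Kato 2004 Thm. 17.4 (surjective-or-Borel ∕ `⊇ SL₂(ℤ₃)`: VOID), its `≥`-half Skinner 2016 Thm. C ∕ Skinner–Urban
((ram): VOID). OPEN; nothing asserted. HONEST FRAMING: a typed SHAPE; CONDITIONAL everywhere it is used; nothing
booked; no census word, tier or label moves (T7); O2 stays OPEN; BSD(E,3) is proved for no class by this file.

References: [Miller2011LMS] Def. 1.1 (arXiv:1010.2431 p. 3); [HoffsteinLuo1997] Theorem (§1, pp. 435–436);
[Skinner2016PacificMC] Thm. C; [Wuthrich2014] Prop. 21; cell board `run/shared/lean/pub/bsd-stepL/STATUS.md`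
RULING 33 (2026-08-27T18:14Z).
-/

open scoped Classical

open WeierstrassCurve NumberField Literature.NumberTheory.EllipticCurves
  Literature.NumberTheory.EllipticCurves.ModularForms
  Literature.NumberTheory.EllipticCurves.Rank1Residual IsDedekindDomain Field
  Literature.NumberTheory.QuadraticFields.Quadratic
  Literature.NumberTheory.Automorphic
  Literature.NumberTheory.GaloisRepresentations Literature.NumberTheory.GaloisCohomology
  Summit.BirchSwinnertonDyer.Rank1Residual Summit.BirchSwinnertonDyer.Rank1Residual.X11b
  Summit.BirchSwinnertonDyer.Rank1Residual.X11b.Three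

-- the cell's Theorems namespace repeats the summit name (Summit.<Summit>.<Problem>), as in every sibling file
set_option linter.dupNamespace false

namespace Summit.BirchSwinnertonDyer.BirchSwinnertonDyer.Theorems.CornerTwistWitness

/-- OPEN (typed open input; implied by `BSD(E^{d_K},3)` for one Hoffstein–Luo twist) — **`CornerTwistWitnessAt W`:
the ∃-recut of the (Tw) conjunct `X11b.Three.CornerTwistAt W` of crux `CornerAtThree`.** For `W/ℚ` globally
minimal with `(E,3) ∈` X11b and `ρ̄_{E,3}` NOT surjective: there is SOME imaginary quadratic field `K` with `d_K`
odd and `d_K < -4`, every `ℓ ∣ N(E)` split in `K` and `3` split in `K` (so `3 ∤ d_K`, `w_K = 2`), with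
`L(E^{(d_K)},1) ≠ 0`, together with a global minimal model `Wd = Cd • E^{(d_K)}` of the twist satisfying the
`3`-part of BSD, `BSDp Wd 3` (Miller's Def. 1.1; the twist has analytic rank `0`). Exactly what the three corner
consumers use of (Tw) (they apply it at ONE field from `exists_oddHeegnerData`); STRICTLY WEAKER than (Tw)
(`cornerTwistWitnessAt_of_cornerTwistAt`). A predicate on `W`; NEVER a theorem in this cell; every result using it
is CONDITIONAL. Body verbatim = `Cruxes/CornerAtThree/IdeaOneDatumRecutUnitTwinSketch.lean` ll. 35–43.
[cite: Miller2011LMS, Def. 1.1 (arXiv:1010.2431 p. 3) (shape of `BSDp`)]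
[cite: HoffsteinLuo1997, Theorem (§1, pp. 435–436) (such a field exists; shape only — nothing asserted)] -/
@[conjecture]
def CornerTwistWitnessAt (W : WeierstrassCurve ℚ) [W.IsElliptic] [W.IsGloballyMinimal] : Prop :=
  ClassX11b W 3 → ¬ Surj W 3 →
    ∃ (K : Type) (_ : Field K) (_ : NumberField K)
      (Wd : WeierstrassCurve ℚ) (_ : Wd.IsElliptic) (_ : Wd.IsGloballyMinimal) (Cd : VariableChange ℚ),
      IsImaginaryQuadratic K ∧ Odd (NumberField.discr K) ∧ NumberField.discr K < -4 ∧
        SatisfiesHeegnerHypothesis (W.conductorNorm ℤ) K ∧ SatisfiesHeegnerHypothesis 3 K ∧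
        (W.quadraticTwist (NumberField.discr K : ℚ)).entireLFunction 1 ≠ 0 ∧
        Cd • W.quadraticTwist (NumberField.discr K : ℚ) = Wd ∧ BSDp Wd 3

/-- **The ∃-recut is implied by the filed ∀-conjunct** (so restating (Tw) as `CornerTwistWitnessAt` loses nothing):
modularity (`hnf`, sign `−1` from `r_an = 1`) and Hoffstein–Luo 1997 (`hHL`) supply an admissible odd Heegner field
with `d_K < -4`, `3` split and `L(E^{d_K},1) ≠ 0` (`exists_admissibleField_of_rootNumber_eq_neg_one`); a global
minimal model of the twist exists over `ℚ` (Néron, `hasGlobalMinimalModel_rat_holds`); `CornerTwistAt W` applied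
there gives `BSDp Wd 3`. Bookkeeping; CONDITIONAL on the two published binders and on (Tw).
-- adapted from Summits/BirchSwinnertonDyer/BirchSwinnertonDyer/Cruxes/CornerAtThree/IdeaOneDatumRecutUnitTwinSketch.lean (l. 89)
[cite: HoffsteinLuo1997, Theorem (§1, pp. 435–436)] [cite: Miller2011LMS, Def. 1.1] -/
theorem cornerTwistWitnessAt_of_cornerTwistAt (hnf : exists_isNewformOf)
    (hHL : HoffsteinLuo1997_exists_twist_L_one_ne_zero)
    (W : WeierstrassCurve ℚ) [W.IsElliptic] [W.IsGloballyMinimal]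
    (hTw : CornerTwistAt W) : CornerTwistWitnessAt W := by
  intro hX hns
  have hr : W.analyticRank = 1 := hX.1
  have hw : W.rootNumber = -1 := by
    rw [WeierstrassCurve.rootNumber_eq_neg_one_pow_analyticRank_of_exists_isNewformOf hnf W, hr]
    norm_num
  obtain ⟨K, _, _, hK, hodd, hlt, hHN, hH3, hLt⟩ :=
    exists_admissibleField_of_rootNumber_eq_neg_one hnf hHL W hw 3
  have hD0 : (NumberField.discr K : ℚ) ≠ 0 := by exact_mod_cast NumberField.discr_ne_zero K
  haveI hEt : (W.quadraticTwist (NumberField.discr K : ℚ)).IsElliptic := W.isElliptic_quadraticTwist hD0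
  obtain ⟨Cd, hCd⟩ := hasGlobalMinimalModel_rat_holds (W.quadraticTwist (NumberField.discr K : ℚ))
  haveI := hCd
  exact ⟨K, inferInstance, inferInstance, Cd • W.quadraticTwist (NumberField.discr K : ℚ), inferInstance,
    hCd, Cd, hK, hodd, hlt, hHN, hH3, hLt, rfl,
    hTw K (Cd • W.quadraticTwist (NumberField.discr K : ℚ)) Cd hX hns hK hodd hHN hLt rfl⟩

end Summit.BirchSwinnertonDyer.BirchSwinnertonDyer.Theorems.CornerTwistWitness
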